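import Literature.MathematicalPhysics.QuantumFieldTheory.Balaban1983to89.B6HolderPairWindowV1

/-!
# `Balaban1983to89.B6HolderPairPlacementV1` — T. Bałaban, *Propagators and renormalization transformations for lattice gauge theories. II*,
# Commun. Math. Phys. **96** (1984) 223–250 [Balaban1984PropagatorsII], Prop. 2.6 (2.137) p. 247 with (2.36) p. 229 and (2.91)–(2.93) p. 239:
# THE BLOCK OF THE SECOND POINT OF A NEAR HÖLDER PAIR TOUCHING `supp h_□` LIES IN THE REACH `□⁺` — the placement (b′) of the p22/p38 interface
# for (2.137)₁,₂ at k levels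

statement-level skeleton of published theorems with citation tags; proofs where landed; nothing here is a claim about the Yang–Mills mass gap

PDF held: `paper:balaban1984-cmp96-propagators-rt-ii` (journal page = PDF page + 222): p. 229 [PDF 7] (2.36) (the cubes `□` of size `2ML^jη` and the
partition `h_□`), p. 239 [PDF 17] (2.91)–(2.93) (`h_□`, `ζ_□` and the cube `□̃`), p. 247 [PDF 25] Prop. 2.6 (2.137) with [4] (1.109) p. 35 (the Hölder
quotient over pairs `x, x′ ∈ Δ̃(y)`, `|x − x′| ≤ ξ`).  OUR READING (HOME/GAPS.md G-B6-2137-2, bookkeeping, no gap in the source claimed): `supp h_□`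
lies within distance `S = M_hL^{j+1}` of the centre of `□` (chart frame), a near pair adds at most `S/8` (`|x − x′|_∞ ≤ L^{j₀+1} ≤ L^{j+1} = S/M_h`,
`M_h ≥ 8`), the block through the second point has side `≤ L^{j+1}` (levels `≤ j + 1` within `3S/2` of the centre), so its centre is within
`S + S/8 + S/16 < 5S/4` of the centre of `□`: it is a block of the reach `Q(□) = □⁺`.

CITATION HEADER (lean-in-tree rule) — WHAT IS REPRODUCED.  Phase-2 file of the `lit-balaban` typed skeleton (HOME `run/shared/lean/pub/lit-balaban/`),
seat **p38 gen 32** (free target (2.137)₂ at k levels; p22/p38 interface of 2026-08-23T23:54Z, item (3)(b), strengthened to `□⁺` as announced in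
p22's INBOX 2026-08-24T01:25Z); SKELETON row **B6.Prop2.6** (cells only; decls of record untouched).  Contents: §1 the bridge between the two torus
sup-distances of the V1 torus (`torusSupNorm_toBox_sub_le_supDist`: p21's label-vector distance `≤` the lattice-calculus `supDist`) and the
conversion of a torus distance `≤ n` at a deep site into a chart distance `≤ n` (`dist_le_of_torus`); §2 **`blkOf_mem_QT_of_near_hT_le`** — on the
multilevel torus, `h^T_□(z′) ≠ 0`, `|z − z′|_T ≤ n`, `8n ≤ S` ⟹ `y(z) ∈ Q^T(□)` (p22 g23's `blkOf_mem_QT_of_near_hT` is the case `n = 1`); §3 on the V1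
torus **`blkV1_mem_ST_of_near_hB`** (`h_□(x′) ≠ 0`, `supDist x x′ ≤ n`, `8n ≤ S` ⟹ `y(x) ∈ □⁺`) and **`blkV1_mem_ST_of_hB_ne_zero_of_supDist_le`**
(the admissible radius `n = L^{j₀(□)+1}`).  Theorems only; no definition, no `def … : Prop`, no new hypothesis; standard axioms.

HONEST SCOPE / DIVERGENCES.  (1) Print does not isolate this statement; it is the geometric content of *"ζ ∈ C₀^∞(Δ̃(y))"*, *"supp J ⊂ Δ(y′)"* (p. 247)
and of the sizes (2.36), used implicitly in *"Reasoning in the same way as in the proof of Proposition 2.2"* (p. 247); the constants `8`, `5/4`, `3/2`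
are those of the tree's reach `Q` (`…B6Cover236MultiLevelBlocks.mem_Q`) and window, not print's.  (2) Integer tori, lattice units, `M_h ≥ 8`, `R ≥ 2L`,
`P′ ≥ 5`; nothing on d = 4 specifically or the continuum; NOT summit progress.  Unit `lit-balaban-p38` (gen 32), 2026-08-24.
-/

namespace Literature.MathematicalPhysics.QuantumFieldTheory.Balaban1983to89.B6HolderPairPlacementV1

open Finset
open LatticeFieldCalculus
open B4ContourShift (supNorm)
open B4Reflection242 (boxDom)
open B4TorusKernel.MultiPeriod (circAbs torusSupNorm)
open B4Sect5Torus (circAbs_zero)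
open B3TorusRadialSums (cdist cdist_le_supDist)
open B6MultiLevelBoxOperator (N0 bigSide one_le_bigSide)
open B6MultiLevelTorusOperator (TDomains one_le_of_mem)
open B6Cover236MultiLevelBlocks (cubes Q mem_Q ctr side)
open B6Geom246MultiLevelBox (bset blkOf toR cen dist_toR_cen_le supNorm_eq_dist)
open B6Geom246MultiLevelTorus (torusSupNorm_neg)
open B6TorusDepthDistance (SiteDeep min_le_torusSupNorm_sub blkOf_eq_blkMap_symm)
open B6Eq238MultiLevelTorus (svec)
open B6GlobalChartV1 (PV toBox toBox_apply blkV1)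
open B6Partition118KLevelFine (hF dist_lt_of_hF_ne_zero lev_window_of_dist_lt_three_halves)
open B6Partition118KLevelTorus (hT)
open B6Partition118KLevelTorusChart (side_le_bigSide_k)
open B6Partition118KLevelTorusCentral (Dch σch cc QT side_cc hT_eq_hF_cc siteDeep_of_dist_le)
open B6Partition118KLevelTorusBinders (torusSupNorm_σch_symm)
open B6Prop26KLevelSkeletonV1 (hB hB_apply ST mem_ST)
open B6CubeWindowV1 (j0 j0_le_level)

variable {d ℓ : ℕ}

/-! ## §1  The two torus sup-distances of the V1 torus; torus distance versus chart distance at a deep site -/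

section Bridge

variable {m K : ℕ} {hd : 1 ≤ d + 1} {hL : Odd (ℓ + 1) ∧ 1 < ℓ + 1} {Mh k : ℕ} {P' : Fin (d + 1) → ℕ}

/-- one coordinate: p21's circular distance of the labels is at most the lattice-calculus circular distance of the classes (in fact equal).
[cite: Balaban1984PropagatorsI, p.17 l.30 (the torus distance), dictionary] -/
theorem circAbs_val_sub_le_cdist {n : ℕ} [NeZero n] (a b : ZMod n) :
    circAbs n (((a.val : ℕ) : ℤ) - ((b.val : ℕ) : ℤ)) ≤ (cdist (a - b) : ℤ) := by
  have hab : (a - b : ZMod n) = (((a.val : ℤ) - (b.val : ℤ) : ℤ) : ZMod n) := by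
    push_cast
    rw [ZMod.natCast_zmod_val, ZMod.natCast_zmod_val]
  have hr : (((a - b).val : ℕ) : ℤ) = ((a.val : ℤ) - (b.val : ℤ)) % (n : ℤ) := by
    rw [hab, ZMod.val_intCast]
  by_cases h0 : a - b = 0
  · have hab0 : ((a.val : ℕ) : ℤ) - ((b.val : ℕ) : ℤ) = 0 := by
      have : a = b := sub_eq_zero.1 h0
      rw [this, sub_self]
    rw [hab0, circAbs_zero]
    exact_mod_cast Nat.zero_le _
  · have hs : (-(a - b)).val = n - (a - b).val := by rw [ZMod.neg_val, if_neg h0]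
    have hlt : (a - b).val < n := ZMod.val_lt _
    unfold circAbs cdist
    rw [← hr, hs, Nat.cast_min, Nat.cast_sub hlt.le]

/-- **THE TWO TORUS SUP-DISTANCES OF THE V1 TORUS**: p21's `|toBox x − toBox x′|_T` (label vectors, periods `N_μ`) is at most the lattice-calculus
`supDist x x′` (circular distances of the classes) — both are the sup-distance of the torus `T_η`. [cite: Balaban1984PropagatorsII, (2.1) p.224 (T_η); Balaban1984PropagatorsI, p.17 l.30, dictionary] -/
theorem torusSupNorm_toBox_sub_le_supDist (hN : ∀ μ, N0 ℓ Mh k P' μ = (PV d ℓ m K hd hL).sitesPerDir 0) (x x' : Site (PV d ℓ m K hd hL) 0) :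
    torusSupNorm (N0 ℓ Mh k P') ((toBox hN x).1 - (toBox hN x').1) ≤ (supDist x x' : ℝ) := by
  simp only [torusSupNorm, Finset.sup'_le_iff]
  intro ν _
  change ((circAbs (N0 ℓ Mh k P' ν) (((x ν).val : ℤ) - ((x' ν).val : ℤ)) : ℤ) : ℝ) ≤ _
  have h1 : circAbs ((PV d ℓ m K hd hL).sitesPerDir 0) (((x ν).val : ℤ) - ((x' ν).val : ℤ)) ≤ (cdist (x ν - x' ν) : ℤ) :=
    circAbs_val_sub_le_cdist (x ν) (x' ν)
  have h2 : cdist (x ν - x' ν) ≤ supDist x x' := cdist_le_supDist x x' ν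
  rw [hN ν]
  exact_mod_cast h1.trans (by exact_mod_cast h2)

variable {P : Fin (d + 1) → ℕ} {R : ℕ}

/-- two sites at torus distance `≤ n`, one of them `w`-deep with `n < w`, are at lattice (chart) distance `≤ n` (p22 g23's `dist_le_one_of_torus` is `n = 1`).
[cite: Balaban1984PropagatorsII, (2.46) p.231, dictionary (torus vs box)] -/
theorem dist_le_of_torus {u v : ↥(boxDom (N0 ℓ Mh k P))} {n : ℕ} {w : ℤ} (hw : (n : ℤ) < w) (hu : SiteDeep (N0 ℓ Mh k P) w u.1)
    (huv : torusSupNorm (N0 ℓ Mh k P) (u.1 - v.1) ≤ n) : dist (toR u.1) (toR v.1) ≤ n := by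
  have hw0 : 0 < w := lt_of_le_of_lt (by exact_mod_cast Nat.zero_le n) hw
  have key := min_le_torusSupNorm_sub hw0 hu v.2
  rw [← supNorm_eq_dist]
  rcases min_choice (supNorm (u.1 - v.1)) ((w : ℤ) : ℝ) with hm | hm
  · rw [hm] at key; exact key.trans huv
  · rw [hm] at key
    have : ((w : ℤ) : ℝ) ≤ (n : ℝ) := key.trans huv
    have hw' : ((n : ℤ) : ℝ) < ((w : ℤ) : ℝ) := by exact_mod_cast hw
    push_cast at hw'
    linarith

end Bridge

/-! ## §2  On the multilevel torus: blocks within `n ≤ S/8` of `supp h^T_□` are blocks of the reach -/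

section Near

variable {Mh k R : ℕ} {P : Fin (d + 1) → ℕ} (D : TDomains d ℓ Mh k P R)

/-- **THE BLOCKS WITHIN `S/8` OF `supp h^T_□` LIE IN `□⁺`** (`M_h ≥ 8`): `h^T_□(z′) ≠ 0`, `|z − z′|_T ≤ n`, `8n ≤ S = M_hL^{j+1}` ⟹ `y(z) ∈ Q^T(□)`
(`supp h_□ ⊂ {dist < S}`, the block through `z` has side `≤ L^{j+1} ≤ S/8`, `Q = {centre ≤ 5S/4}`; p22 g23's `blkOf_mem_QT_of_near_hT` is `n = 1`).
[cite: Balaban1984PropagatorsII, (2.36) p.229, p.239/p.247 (supports of h_□, ζ_□ in □̃ — our paraphrase, not a printed sentence), bookkeeping] -/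
theorem blkOf_mem_QT_of_near_hT_le (hM8 : 8 ≤ Mh) (hR : 2 * (ℓ + 1) ≤ R) (hP5 : ∀ μ, 5 ≤ P μ) {hMh1 : 1 ≤ Mh} (hP4 : ∀ μ, 4 ≤ P μ)
    (c : ↥(cubes D.toDomains)) {z z' : ↥(boxDom (N0 ℓ Mh k P))} (h : hT D c z' ≠ 0) {n : ℕ} (hn : 8 * n ≤ bigSide ℓ Mh c.1.1)
    (hzz' : torusSupNorm (N0 ℓ Mh k P) (z.1 - z'.1) ≤ n) :
    blkOf D.toDomains z ∈ QT D hMh1 hP4 c := by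
  rw [hT_eq_hF_cc hMh1 hP4 c z'] at h
  -- in the canonical chart: `x = σ_c⁻¹ z` is within `n` of `x′ = σ_c⁻¹ z′ ∈ supp h^F`
  have hT1 : torusSupNorm (N0 ℓ Mh k P) (((σch D c).symm z').1 - ((σch D c).symm z).1) ≤ n := by
    rw [torusSupNorm_σch_symm, show z'.1 - z.1 = -(z.1 - z'.1) by abel, torusSupNorm_neg (one_le_of_mem z.2)]; exact hzz'
  have hx'c := dist_lt_of_hF_ne_zero (Dch D c) hMh1 h
  set x := (σch D c).symm z with hx
  set x' := (σch D c).symm z' with hx'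
  have hS : side (Dch D c) (cc D hMh1 hP4 c) = (bigSide ℓ Mh c.1.1 : ℝ) := side_cc hMh1 hP4 c
  have hS0 : (0 : ℝ) < (bigSide ℓ Mh c.1.1 : ℝ) := by
    have := one_le_bigSide hMh1 (ℓ := ℓ) c.1.1
    exact_mod_cast Nat.lt_of_lt_of_le Nat.zero_lt_one this
  -- `x′` is `S_k`-deep, so the torus distance `≤ n < S_k` is a chart distance
  have hdeep : SiteDeep (N0 ℓ Mh k P) (bigSide ℓ Mh k : ℤ) x'.1 := by
    refine siteDeep_of_dist_le hMh1 hP5 (hP4 := hP4) c ?_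
    rw [← hS]; linarith
  have hnS : (n : ℤ) < (bigSide ℓ Mh k : ℤ) := by
    have h1 : bigSide ℓ Mh c.1.1 ≤ bigSide ℓ Mh k := by
      have := side_le_bigSide_k (Dch D c) (cc D hMh1 hP4 c); rw [hS] at this; exact_mod_cast this
    have h2 : 1 ≤ bigSide ℓ Mh c.1.1 := one_le_bigSide hMh1 (ℓ := ℓ) c.1.1
    have : n < bigSide ℓ Mh k := by omega
    exact_mod_cast this
  have hnear : dist (toR x'.1) (toR x.1) ≤ n := dist_le_of_torus hnS hdeep hT1
  have hnear' : dist (toR x.1) (toR x'.1) ≤ n := by rw [dist_comm]; exact hnear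
  have hn8 : 8 * (n : ℝ) ≤ side (Dch D c) (cc D hMh1 hP4 c) := by rw [hS]; exact_mod_cast hn
  have hp1 : (1 : ℝ) ≤ (((ℓ + 1) ^ (c.1.1 + 1) : ℕ) : ℝ) := by exact_mod_cast Nat.one_le_pow _ _ (by omega)
  have h8 : 8 * (((ℓ + 1) ^ (c.1.1 + 1) : ℕ) : ℝ) ≤ side (Dch D c) (cc D hMh1 hP4 c) := by
    rw [hS]; unfold bigSide; push_cast
    have : (8 : ℝ) ≤ Mh := by exact_mod_cast hM8
    have hp : (0 : ℝ) ≤ ((ℓ : ℝ) + 1) ^ (c.1.1 + 1) := by positivity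
    nlinarith
  have h32 : dist (toR x.1) (ctr (Dch D c) (cc D hMh1 hP4 c)) < 3 / 2 * side (Dch D c) (cc D hMh1 hP4 c) := by
    linarith [dist_triangle (toR x.1) (toR x'.1) (ctr (Dch D c) (cc D hMh1 hP4 c))]
  have hlev := (lev_window_of_dist_lt_three_halves (Dch D c) hMh1 hR h32).2
  -- the block of `x` in the chart frame is in `Q`: its centre is within `(L^{j+1} − 1)/2 + n + S ≤ 5S/4` of the centre
  have hcen := dist_toR_cen_le (Dch D c) (rfl : blkOf (Dch D c) x = blkOf (Dch D c) x)
  have hL1 : 1 ≤ ℓ + 1 := by omega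
  have hpow : (((ℓ + 1) ^ (blkOf (Dch D c) x).1.1 : ℕ) : ℝ) ≤ (((ℓ + 1) ^ (c.1.1 + 1) : ℕ) : ℝ) := by
    exact_mod_cast Nat.pow_le_pow_right hL1 hlev
  have hQ : blkOf (Dch D c) x ∈ Q (Dch D c) (cc D hMh1 hP4 c) := by
    refine (mem_Q (Dch D c)).2 ?_
    calc dist (cen (Dch D c) (blkOf (Dch D c) x)) (ctr (Dch D c) (cc D hMh1 hP4 c))
        ≤ dist (toR x.1) (cen (Dch D c) (blkOf (Dch D c) x)) + dist (toR x.1) (ctr (Dch D c) (cc D hMh1 hP4 c)) :=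
          dist_triangle_left _ _ _
      _ ≤ dist (toR x.1) (cen (Dch D c) (blkOf (Dch D c) x)) + (dist (toR x.1) (toR x'.1) +
            dist (toR x'.1) (ctr (Dch D c) (cc D hMh1 hP4 c))) := by linarith [dist_triangle (toR x.1) (toR x'.1) (ctr (Dch D c) (cc D hMh1 hP4 c))]
      _ ≤ 5 / 4 * side (Dch D c) (cc D hMh1 hP4 c) := by nlinarith
  -- back to the torus
  unfold QT
  rw [blkOf_eq_blkMap_symm (D := D) hMh1 (fun μ => le_trans (by norm_num) (hP4 μ)) (svec ℓ k c.1.1 c.1.2) z]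
  exact Finset.mem_image_of_mem _ hQ

end Near

/-! ## §3  On the V1 torus: the placement `h_□(x′) ≠ 0 ⇒ y(x) ∈ □⁺` for near pairs -/

section V1

variable {m K : ℕ} {hd : 1 ≤ d + 1} {hL : Odd (ℓ + 1) ∧ 1 < ℓ + 1} {Mh k R : ℕ} {P' : Fin (d + 1) → ℕ}
  (hN : ∀ μ, N0 ℓ Mh k P' μ = (PV d ℓ m K hd hL).sitesPerDir 0) (D : TDomains d ℓ Mh k P' R) {hMh1 : 1 ≤ Mh} {hP4 : ∀ μ, 4 ≤ P' μ}

/-- **THE PLACEMENT OF A NEAR PAIR**: `h_□(x′) ≠ 0`, `|x − x′|_∞ ≤ n`, `8n ≤ S` ⟹ `y(x) ∈ □⁺` (all directions of the bonds).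
[cite: Balaban1984PropagatorsII, Prop. 2.6 (2.137) p.247 (x, x′ ∈ Δ̃(y)), (2.36) p.229, (2.91)–(2.93) p.239; Balaban1984PropagatorsI, (1.109) p.35] -/
theorem blkV1_mem_ST_of_near_hB (hM8 : 8 ≤ Mh) (hR : 2 * (ℓ + 1) ≤ R) (hP5 : ∀ μ, 5 ≤ P' μ) (c : ↥(cubes D.toDomains))
    {x x' : PBond (PV d ℓ m K hd hL) 0} (h : hB hN D c x' ≠ 0) {n : ℕ} (hn : 8 * n ≤ bigSide ℓ Mh c.1.1) (hxx' : supDist x.src x'.src ≤ n) :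
    blkV1 hN D x ∈ ST D hMh1 hP4 c := by
  rw [hB_apply] at h
  refine (mem_ST D hMh1 hP4 c _).2 (blkOf_mem_QT_of_near_hT_le D hM8 hR hP5 hP4 c h hn ?_)
  exact (torusSupNorm_toBox_sub_le_supDist hN x.src x'.src).trans (by exact_mod_cast hxx')

/-- **THE ADMISSIBLE RADIUS**: `h_□(x′) ≠ 0`, `|x − x′|_∞ ≤ L^{j₀(□)+1}` ⟹ `y(x) ∈ □⁺` (`8L^{j₀+1} ≤ 8L^{j+1} ≤ M_hL^{j+1} = S`; the radius of p22 g26's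
`…B6HolderPairWindowV1.pair_window`). [cite: Balaban1984PropagatorsII, Prop. 2.6 (2.137) p.247, (2.36) p.229, (2.91)–(2.93) p.239; Balaban1984PropagatorsI, (1.109) p.35] -/
theorem blkV1_mem_ST_of_hB_ne_zero_of_supDist_le (hM8 : 8 ≤ Mh) (hR2 : 2 * (ℓ + 1) ^ 2 ≤ R) (hP5 : ∀ μ, 5 ≤ P' μ) (c : ↥(cubes D.toDomains))
    {x x' : PBond (PV d ℓ m K hd hL) 0} (h : hB hN D c x' ≠ 0) (hxx' : supDist x.src x'.src ≤ (ℓ + 1) ^ (j0 hMh1 hP4 c + 1)) :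
    blkV1 hN D x ∈ ST D hMh1 hP4 c := by
  have hR : 2 * (ℓ + 1) ≤ R := le_trans (by nlinarith : 2 * (ℓ + 1) ≤ 2 * (ℓ + 1) ^ 2) hR2
  refine blkV1_mem_ST_of_near_hB hN D hM8 hR hP5 c h ?_ hxx'
  have hj := (j0_le_level (D := D) (hMh1 := hMh1) (hP4 := hP4) (c := c) hL hR2).1
  unfold bigSide
  calc 8 * (ℓ + 1) ^ (j0 hMh1 hP4 c + 1) ≤ Mh * (ℓ + 1) ^ (j0 hMh1 hP4 c + 1) := Nat.mul_le_mul_right _ hM8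
    _ ≤ Mh * (ℓ + 1) ^ (c.1.1 + 1) := Nat.mul_le_mul_left _ (Nat.pow_le_pow_right (by omega) (by omega))

end V1

end Literature.MathematicalPhysics.QuantumFieldTheory.Balaban1983to89.B6HolderPairPlacementV1
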